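import Summits.BirchSwinnertonDyer.BirchSwinnertonDyer.Theorems.PrintCFramBottomClassIndexLawFiveLeLevelDictionaryBetaSource
import Summits.BirchSwinnertonDyer.BirchSwinnertonDyer.Theorems.PrintCFramBottomClassIndexLawFiveLeLevelDictionaryBetaAvatar
import Summits.BirchSwinnertonDyer.BirchSwinnertonDyer.Theorems.PrintCFramBottomClassIndexLawFiveLeLevelDictionaryBetaGenerator
import Summits.BirchSwinnertonDyer.BirchSwinnertonDyer.Theorems.PrintCFramBottomClassIndexLawFiveLeLevelDictionaryRationalLine
import Summits.BirchSwinnertonDyer.BirchSwinnertonDyer.Theorems.PrintCFramBottomClassIndexLawFiveLeLevelDictionaryLocalInputs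
import HarnessLib

/-!
# Route `PrintCFram`, crux C2 `BottomClassIndexLawFiveLe` (stmt-BirchSwinnertonDyer-20372), line
# `eisenstein-resource-bdp-line` (registry v19; LEAD g10 report §2(d)(β), §4 `classFactor_imp_levelPos_or_sha`):
# **THE (β) SOURCE ON THE CLASS, IN B1's BINDER CURRENCY** — for a class member and its odd Kriz–Li character `ψ`
# with NON-UNIT class factor, Mazur–Wiles produces a non-zero unramified equivariant homomorphism on the kernel of
# the SUB character (ALIGNED: `ψ` is the sub character) or of the QUOTIENT character (TRANSVERSE) of the rational
# line `Φ ≤ W[p]`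
# (cell `bsd-print-cfram`, width seat `bsd-line-cfram-p1-w5` g3; helper `--supports` 20372; 0 defs, 0 facts,
# 0 sorry)

HONEST FRAMING. Nothing about BSD is proved here, and nothing of any stub; CONDITIONAL on the named fact
`MazurWiles1984.thm2_card_oddChiClassGroup_eq_bernoulli` (Ribet direction) by design (LEAD g10, 21:28:52Z), and on
`B_{1,ψ̃⁻¹} ≠ 0` (non-vanishing of `L(0, ψ̃⁻¹)`, not in the tree; both are what Mazur–Wiles' theorem presupposes). The
binders are those of the registered stub B1 `stub_bsdp_of_classFactor` (`W/ℚ` globally minimal with CM, `p ≥ 5`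
CM-RAMIFIED, `(f, ψ, ω)` with `ψ` odd, `ω` Teichmüller and the trace form `hss`, `‖B_{1,ψ̃⁻¹}‖_p ≤ p⁻¹`) MINUS
`r_an(W) = 1` (not needed). ASSEMBLY: w6 g3's `LevelDictionaryAlpha.exists_rationalLineData_of_hss` (the line `Φ`,
`θ_S`, `θ_Q`, `θ_S θ_Q = χ̄_p`, the lift `ψ₁`, the dichotomy `ψ↑ = ψ₁↑ ∨ ψ↑ = ψ₁⁻¹↑ω↑`) → w5 g3's avatar lemmas
(`…BetaAvatar`: `ψ(χ_f τ) = Teich(θ τ)` for `θ = θ_S` resp. `θ_Q`; `ψ̃` not Teichmüller-congruent because the inertia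
homothety at `p` has `θ g ≠ χ̄_p g`, w6 g3's `exists_mem_decompositionSubgroup_apply_ne_cyclotomic_at_p`) → w5 g3's
(β) source `LevelDictionaryBeta.exists_equivariantHom_of_odd_avatar_of_norm_bernoulli_lt_one` (w6 g2's Mazur–Wiles
character on `L = ℚ̄^{ker θ}` transported to `Γ_ℚ`).

* **`exists_equivariantHom_sub_or_quot_of_classFactor`** — the conclusion is the rational line `Φ` (order `p`) with
  its two characters, AND: EITHER a `G₀ : Γ_ℚ → Φ.Sub` continuous and additive on `N_S = ker(Γ_ℚ → Aut Φ.Sub)`,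
  `Γ_ℚ`-equivariant, killing every `N_S ∩ I_𝔓`, non-zero on `N_S` (ALIGNED), OR the same valued in `Φ.Quot` on
  `N_Q = ker(Γ_ℚ → Aut Φ.Quot)` (TRANSVERSE) — in each case LITERALLY the output 5-tuple of w4 g8's
  `LevelDictionary.hom_of_unramified_class`, so that its converse (the inflation–restriction LINK
  `…LevelDictionaryDescent`, w4 g8, in flight) turns it into an everywhere-unramified NON-ZERO class of
  `H¹(ℚ, Φ.Sub)` (resp. `H¹(ℚ, Φ.Quot)`), after which w5 g3's
  `LevelDictionaryBeta.sha_or_generator_levelPos_of_unramified_sub_class_cmRamified` (p673094) reads, in the aligned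
  case, «`Ш(W)[p] ≠ 0` OR the generator has LEVEL `n ≥ 1`» — LEAD g10's (β).

THEOREMS ONLY; no definition, no named fact, no `sorry`. BSD is not proved by any of this; no summit statement is
proved by this seat. References: [MazurWiles1984] Thm. 2 (p. 216); [Washington1997] §5.1, §6.3, Thm. 6.17;
[SerreGaloisCohomology1997] I.§2.6 (b); [GrossLMS1991] §9; the LEAD g10 report §2(d), §4.
-/

set_option autoImplicit false
-- `…BirchSwinnertonDyer.BirchSwinnertonDyer.Theorems…` is the problem's mandated namespace (D-0017).
set_option linter.dupNamespace false

noncomputable section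

open scoped Classical Pointwise

namespace Summit.BirchSwinnertonDyer.BirchSwinnertonDyer.Theorems.PrintCFram.LevelDictionaryBeta

open NumberField IsDedekindDomain Field WeierstrassCurve DirichletCharacter
open Literature.NumberTheory.EllipticCurves Literature.NumberTheory.GaloisRepresentations
  Literature.NumberTheory.EllipticCurves.KrizLi2019 Literature.NumberTheory.NumberFields
open Literature.NumberTheory.EllipticCurves.Rank1Residual (CMRamified)
open Summit.BirchSwinnertonDyer.Rank1Residual
open Summit.BirchSwinnertonDyer.BirchSwinnertonDyer.Theorems.PrintCFram.LevelDictionaryAlpha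

variable (W : WeierstrassCurve ℚ) [W.IsElliptic] [W.IsGloballyMinimal] {p : ℕ} [hp : Fact p.Prime]

/-- **THE (β) SOURCE ON THE CLASS (CONDITIONAL on Mazur–Wiles Thm. 2).** `W/ℚ` globally minimal with CM, `p ≥ 5`
CM-RAMIFIED; `(f, ψ, ω)` with `ψ` ODD, `ω` Teichmüller and the trace form
`‖a_ℓ(W) − (ψ(ℓ) + ψ⁻¹(ℓ)ω(ℓ))‖_p < 1` (`ℓ ∤ pN_W`); `B_{1,ψ̃⁻¹} ≠ 0` and the CLASS FACTOR NON-UNIT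
`‖B_{1,ψ̃⁻¹}‖_p ≤ p⁻¹`. THEN there are a `Γ_ℚ`-stable line `Φ ≤ W[p]` of order `p` and characters `θ_S`, `θ_Q`
(`g • x = θ_S(g)·x` on `Φ`, `g • y = θ_Q(g)·y` on `W[p]/Φ`, `θ_S g = 1 ↔ g` fixes `Φ`, `θ_Q g = 1 ↔ g` fixes
`W[p]/Φ`, `θ_S θ_Q = χ̄_p`) such that EITHER (ALIGNED, `ψ` the avatar of `θ_S`) some `G₀ : Γ_ℚ → Φ` is continuous and
additive on `N_S = ker(Γ_ℚ → Aut Φ)`, `Γ_ℚ`-equivariant, kills `N_S ∩ I_𝔓` for every prime `𝔓` of `\bar ℤ` and does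
not vanish on `N_S`, OR (TRANSVERSE, `ψ` the avatar of `θ_Q`) the same valued in `W[p]/Φ` on
`N_Q = ker(Γ_ℚ → Aut(W[p]/Φ))`. [cite: MazurWiles1984, Thm. 2 (p. 216)] [cite: Washington1997, §6.3 and Thm. 6.17]
[cite: GrossLMS1991, §9] [cite: SerreGaloisCohomology1997, I.§2.6 (b)] -/
theorem exists_equivariantHom_sub_or_quot_of_classFactor
    (hMW : MazurWiles1984.thm2_card_oddChiClassGroup_eq_bernoulli)
    (hCM : W.HasCM) (hram : CMRamified W p) (h5 : 5 ≤ p)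
    {f : ℕ} [NeZero f] (ψ : DirichletCharacter ℚ_[p] f) (ω : DirichletCharacter ℚ_[p] p)
    (hψ : ψ.Odd) (hω : IsTeichmullerCharacter ω)
    (hss : ∀ ℓ : ℕ, ℓ.Prime → ¬ (ℓ ∣ p * W.conductorNorm ℤ) →
      ‖((W.LFunction ℓ : ℤ) : ℚ_[p]) - (ψ (ℓ : ZMod f) + ψ⁻¹ (ℓ : ZMod f) * ω (ℓ : ZMod p))‖ < 1)
    (hB0 : bernoulliOnePrim ψ⁻¹ ≠ 0) (hB : ‖bernoulliOnePrim ψ⁻¹‖ ≤ (p : ℝ)⁻¹) :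
    ∃ (Φ : X2.ResidualDevissageModules.StableSubgroup (absoluteGaloisGroup ℚ) (W.geomTorsion (p : ℤ)))
      (θS θQ : absoluteGaloisGroup ℚ →* (ZMod p)ˣ),
      Nat.card Φ.Sub = p ∧
      (∀ (g : absoluteGaloisGroup ℚ) (x : Φ.Sub), g • x = (((θS g : ZMod p).val : ℕ) : ℤ) • x) ∧
      (∀ g : absoluteGaloisGroup ℚ, θS g = 1 ↔ ∀ x : Φ.Sub, g • x = x) ∧
      (∀ (g : absoluteGaloisGroup ℚ) (y : Φ.Quot), g • y = (((θQ g : ZMod p).val : ℕ) : ℤ) • y) ∧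
      (∀ g : absoluteGaloisGroup ℚ, θQ g = 1 ↔ ∀ y : Φ.Quot, g • y = y) ∧
      (∀ g : absoluteGaloisGroup ℚ, θS g * θQ g = modNCyclotomicCharacter ℚ p g) ∧
      ((∃ G₀ : absoluteGaloisGroup ℚ → Φ.Sub,
          (Continuous fun m : (MulAction.toPermHom (absoluteGaloisGroup ℚ) Φ.Sub).ker => G₀ m) ∧
          (∀ a ∈ (MulAction.toPermHom (absoluteGaloisGroup ℚ) Φ.Sub).ker,
            ∀ b ∈ (MulAction.toPermHom (absoluteGaloisGroup ℚ) Φ.Sub).ker, G₀ (a * b) = G₀ a + G₀ b) ∧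
          (∀ (g : absoluteGaloisGroup ℚ), ∀ m ∈ (MulAction.toPermHom (absoluteGaloisGroup ℚ) Φ.Sub).ker,
            G₀ (g * m * g⁻¹) = g • G₀ m) ∧
          (∀ (ℓ : HeightOneSpectrum (𝓞 ℚ)) (𝔓 : Ideal (absIntegers (𝓞 ℚ) ℚ)), 𝔓 ∈ ℓ.primesAbove →
            ∀ m ∈ (MulAction.toPermHom (absoluteGaloisGroup ℚ) Φ.Sub).ker,
              m ∈ 𝔓.inertia (absoluteGaloisGroup ℚ) → G₀ m = 0) ∧
          ∃ m ∈ (MulAction.toPermHom (absoluteGaloisGroup ℚ) Φ.Sub).ker, G₀ m ≠ 0) ∨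
       (∃ G₀ : absoluteGaloisGroup ℚ → Φ.Quot,
          (Continuous fun m : (MulAction.toPermHom (absoluteGaloisGroup ℚ) Φ.Quot).ker => G₀ m) ∧
          (∀ a ∈ (MulAction.toPermHom (absoluteGaloisGroup ℚ) Φ.Quot).ker,
            ∀ b ∈ (MulAction.toPermHom (absoluteGaloisGroup ℚ) Φ.Quot).ker, G₀ (a * b) = G₀ a + G₀ b) ∧
          (∀ (g : absoluteGaloisGroup ℚ), ∀ m ∈ (MulAction.toPermHom (absoluteGaloisGroup ℚ) Φ.Quot).ker,
            G₀ (g * m * g⁻¹) = g • G₀ m) ∧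
          (∀ (ℓ : HeightOneSpectrum (𝓞 ℚ)) (𝔓 : Ideal (absIntegers (𝓞 ℚ) ℚ)), 𝔓 ∈ ℓ.primesAbove →
            ∀ m ∈ (MulAction.toPermHom (absoluteGaloisGroup ℚ) Φ.Quot).ker,
              m ∈ 𝔓.inertia (absoluteGaloisGroup ℚ) → G₀ m = 0) ∧
          ∃ m ∈ (MulAction.toPermHom (absoluteGaloisGroup ℚ) Φ.Quot).ker, G₀ m ≠ 0)) := by
  have hp2 : p ≠ 2 := by omega
  have hp1 : (1 : ℝ) < p := by exact_mod_cast hp.out.one_lt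
  have hB' : ‖bernoulliOnePrim ψ⁻¹‖ < 1 := lt_of_le_of_lt hB (inv_lt_one_of_one_lt₀ hp1)
  -- the rational line of the class with both characters and the dichotomy
  obtain ⟨Φ, θS, θQ, m, _, b, ψ₁, hf, hm, hpM, hcard, hθS, hkerS, hθQ, hkerQ, hprod, hθSb, hθQb, hψ₁, hdich⟩ :=
    exists_rationalLineData_of_hss (W := W) (p := p) hCM h5 hram ψ ω hω hss
  -- continuity of the orbit maps on the line and on the quotient
  have hcontS : ∀ x : Φ.Sub, Continuous fun g : absoluteGaloisGroup ℚ ↦ g • x :=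
    Φ.continuous_smul_sub (HerbrandLineRestriction.continuous_smul_geomTorsion W (p : ℤ))
  have hcontQ : ∀ y : Φ.Quot, Continuous fun g : absoluteGaloisGroup ℚ ↦ g • y :=
    Φ.continuous_smul_quot (HerbrandLineRestriction.continuous_smul_geomTorsion W (p : ℤ))
  have hcardQ : Nat.card Φ.Quot = p := HerbrandLineRestriction.natCard_quot_eq_of_card_sub W Φ hcard
  -- the inertia homothety at `p`: `θ_S g ≠ χ̄_p g` and `θ_Q g ≠ χ̄_p g` for some `g`
  obtain ⟨v, hv⟩ := exists_heightOneSpectrum_rat_natCast_mem hp.out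
  obtain ⟨⟨gS, -, hgS⟩, ⟨gQ, -, hgQ⟩⟩ := exists_mem_decompositionSubgroup_apply_ne_cyclotomic_at_p W Φ hCM h5 hram
    hcard θS θQ hθS hθQ hprod hv (adicCompletionPrime_mem_primesAbove ℚ v)
  refine ⟨Φ, θS, θQ, hcard, hθS, hkerS, hθQ, hkerQ, hprod, ?_⟩
  rcases hdich with hel | hel
  · -- ALIGNED: `ψ` is the avatar of `θ_S`
    left
    have hlam : ∀ τ : absoluteGaloisGroup ℚ, ψ ((modNCyclotomicCharacter ℚ f τ : (ZMod f)ˣ) : ZMod f) =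
        (((Kato2004.teichmullerChar p (θS τ) : ℤ_[p]ˣ) : ℤ_[p]) : ℚ_[p]) :=
      apply_modNCyclotomicCharacter_eq_teich_sub b hψ₁ θS hθSb hf hm ψ hel
    have hlamω := not_teichmullerCongruent_of_exists_apply_ne hp2 ψ θS hlam hψ ⟨gS, hgS⟩
    exact exists_equivariantHom_of_odd_avatar_of_norm_bernoulli_lt_one hMW hp2 hcard hcontS θS hθS hkerS ψ hlam hψ
      hlamω hB0 hB'
  · -- TRANSVERSE: `ψ` is the avatar of `θ_Q`
    right
    have hlam : ∀ τ : absoluteGaloisGroup ℚ, ψ ((modNCyclotomicCharacter ℚ f τ : (ZMod f)ˣ) : ZMod f) =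
        (((Kato2004.teichmullerChar p (θQ τ) : ℤ_[p]ˣ) : ℤ_[p]) : ℚ_[p]) :=
      apply_modNCyclotomicCharacter_eq_teich_quot hp2 b hψ₁ hω θQ hθQb hf hm hpM ψ hel
    have hlamω := not_teichmullerCongruent_of_exists_apply_ne hp2 ψ θQ hlam hψ ⟨gQ, hgQ⟩
    exact exists_equivariantHom_of_odd_avatar_of_norm_bernoulli_lt_one hMW hp2 hcardQ hcontQ θQ hθQ hkerQ ψ hlam hψ
      hlamω hB0 hB'

end Summit.BirchSwinnertonDyer.BirchSwinnertonDyer.Theorems.PrintCFram.LevelDictionaryBeta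

end
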